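import Literature.Analysis.FluidPDE.NSRegFourierPressure
import Literature.Analysis.FluidPDE.NSRegFourierWeakForm
import Literature.Analysis.FluidPDE.NSRegFourierMollifier
import Literature.Analysis.FluidPDE.NSRegFourierDrift
import Literature.Analysis.FluidPDE.ClassicalDriftNSHalfLine
import HarnessLib

/-!
# The global regularised solution on the time half-line (physical side)

Analysis/FluidPDE file serving the discharge of
`Literature.Analysis.FluidPDE.leray_regularised_wellposed` (Leray 1934, Ch. V §§26–27;
Ożański–Pooley 2018, Thm. 6.33). The Fourier-side global construction `gSol` of
`NSRegFourierGlobal` (uniform restarts of the Picard scheme, `GlobalHyp c m K a`) yields, for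
every `T > 0`, a regularised setup on `[0, T]` (`NSRegFourierSolution.RegSetup` with
`V(t) = gSol (min t T)`, `NSRegFourierBootstrap`), whose synthesized fields do not depend on `T`
on `[0, T]`. This file packages the resulting **global** physical fields

  `u(t) = Re 𝓕 (gSol t)`, `Ju(t) = Re 𝓕 (m · gSol t)`, `p(t) = Re 𝓕 (presSymbol (m · gSol t) (gSol t))`

on `[0, ∞) × E` with the properties consumed by the fact and by Leray's separation of energy
(`LeraySeparationOfEnergy.LerayTailHyp`): for the multiplier `m = 𝓕θ` of a bump kernel `χ`,
`(Ju, u, p)` is a classical solution of the drift system `∂ₜu + (Ju·∇)u = νΔu − ∇p`,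
`div u = div Ju = 0` on every `[0, T]` (`NSRegFourierDrift`), `u(0) = Re 𝓕 a`, `Ju(t) = J_χ u(t)`
(`NSRegFourierMollifier`), `u ∈ C([0, ∞); L²)`, the energy equality with finite dissipation
(`NSRegFourierEnergy`), Leray's regularised weak form between two times (`NSRegFourierWeakForm`)
and the pressure bound `‖p‖₂ ≤ (card ι)² ‖|Ju||u|‖₂` (`NSRegFourierPressure`) —
`exists_global_regularised_fields`. Also: transport of classical drift solutions along slice-wise
equal fields (`IsClassicalDriftNSSolutionOn.congr`).

## References

* J. Leray, *Sur le mouvement d'un liquide visqueux emplissant l'espace*, Acta Math. 63 (1934),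
  Ch. V §26, pp. 231–232 (the regularised system (5.1) has a regular solution for all `t > 0`,
  with `W(t)` non-increasing), §27. [Leray1934]
* W. S. Ożański, B. C. Pooley, *Leray's fundamental work on the Navier–Stokes equations: a modern
  review*, LMS Lecture Note Ser. 452 (2018) = arXiv:1708.09787, Thm. 6.33, (6.77)–(6.80), (6.85),
  (6.89). [OzanskiPooley2018]
-/

noncomputable section

open MeasureTheory Real Set Filter Topology Function Complex FourierTransform InnerProductSpace TopologicalSpace
open scoped FourierTransform RealInnerProductSpace ENNReal ComplexConjugate Laplacian

namespace Literature.Analysis.FluidPDE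

/-! ### Transport of classical drift solutions along slice-wise equal fields -/

section Congr

variable {E : Type*} [NormedAddCommGroup E] [InnerProductSpace ℝ E] [FiniteDimensional ℝ E]
variable {S : Set ℝ} {ν : ℝ} {w u w' u' : ℝ → E → E} {p p' : ℝ → E → ℝ}

/-- A classical drift solution on `S` stays one after changing the fields off the time set `S`
(the predicate only sees the slices `t ∈ S`: joint smoothness on `S × E`, `derivWithin` in `S`,
and the pointwise equations for `t ∈ S`). [folklore] -/
theorem IsClassicalDriftNSSolutionOn.congr (h : IsClassicalDriftNSSolutionOn S ν w u p)
    (hu : ∀ t ∈ S, u' t = u t) (hw : ∀ t ∈ S, w' t = w t) (hp : ∀ t ∈ S, p' t = p t) :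
    IsClassicalDriftNSSolutionOn S ν w' u' p' where
  smooth_velocity := h.smooth_velocity.congr fun z hz => by
    simp only [uncurry, hu z.1 (mem_prod.1 hz).1]
  smooth_drift := h.smooth_drift.congr fun z hz => by
    simp only [uncurry, hw z.1 (mem_prod.1 hz).1]
  smooth_pressure := h.smooth_pressure.congr fun z hz => by
    simp only [uncurry, hp z.1 (mem_prod.1 hz).1]
  momentum t ht x := by
    have h1 : timeDerivWithin S u' t x = timeDerivWithin S u t x := by
      rw [timeDerivWithin_apply, timeDerivWithin_apply]
      exact derivWithin_congr (fun s hs => by rw [hu s hs]) (by rw [hu t ht])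
    rw [h1, hu t ht, hw t ht, hp t ht]
    exact h.momentum t ht x
  divFree t ht := by rw [hu t ht]; exact h.divFree t ht
  divFree_drift t ht := by rw [hw t ht]; exact h.divFree_drift t ht

end Congr

/-! ### The global fields -/

namespace FourierNS

open ClayDatum (reVec reVec_apply)

variable {ι : Type*} [Fintype ι] [DecidableEq ι]
variable {ν : ℝ} {χ : ContDiffBump (0 : EuclideanSpace ℝ ι)} {K : ℕ} {a : EuclideanSpace ℝ ι → ι → ℂ}

/-- **The regularised setup on `[0, T]` carried by the global Fourier solution**: for `T > 0`
there is a `RegSetup` with viscosity `ν`, multiplier `m = 𝓕θ`, final time `T` and coefficient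
field `V(t) = gSol (min t T)`, so `V(t) = gSol t` on `[0, T]` (`GlobalHyp.isRegMildAll_gSol`). [folklore] -/
theorem exists_regSetup_gSol (hν : 0 < ν) (h : GlobalHyp (4 * π ^ 2 * ν) (msymbol χ) K a)
    (hall : ∀ K' : ℕ, eLpNorm (wfun K' a) 2 volume < ⊤) {T : ℝ} (hT : 0 < T) :
    ∃ d : RegSetup ι, d.ν = ν ∧ d.m = msymbol χ ∧ d.T = T ∧
      ∀ t ∈ Icc 0 T, d.V t = gSol (4 * π ^ 2 * ν) (msymbol χ) K a t :=
  ⟨⟨ν, hν, msymbol χ, T, hT, fun t => gSol (4 * π ^ 2 * ν) (msymbol χ) K a (min t T), h.isRegMildAll_gSol hall hT⟩,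
    rfl, rfl, rfl, fun t ht => by
      show gSol (4 * π ^ 2 * ν) (msymbol χ) K a (min t T) = _
      rw [min_eq_left ht.2]⟩

/-- **The global regularised solution on `[0, ∞)`, physical side** (Leray 1934, Ch. V §26;
Ożański–Pooley 2018, Thm. 6.33): let `ν > 0`, `χ` a bump kernel with multiplier `m = 𝓕θ`, and `a`
a Fourier datum with `GlobalHyp (4π²ν) m K a` lying in every weighted `L²`. Then the fields
`u(t) = Re 𝓕(gSol t)`, `w(t) = Re 𝓕(m · gSol t)`, `p(t) = Re 𝓕(presSymbol (m · gSol t) (gSol t))`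
satisfy: `(w, u, p)` is a classical solution of the drift system on every `[0, T]`; `u(0) = Re 𝓕 a`;
`w(t) = J_χ u(t)` for `t ≥ 0`; `u ∈ C([0, ∞); L²)`; the dissipation is finite on every `(0, T)` and
the energy equality `½‖u(t)‖² + ν∫ₛᵗ∫|∇u|² = ½‖u(s)‖²` holds for `0 ≤ s ≤ t`; Leray's regularised
weak form holds between any two times `0 ≤ s ≤ t` against divergence-free space–time test
fields; and `‖p(t)‖₂ ≤ (card ι)² ‖|w(t)||u(t)|‖₂` for `t ≥ 0`. [cite: Leray1934, Ch. V §26 (5.1)] -/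
theorem exists_global_regularised_fields (hν : 0 < ν) (h : GlobalHyp (4 * π ^ 2 * ν) (msymbol χ) K a)
    (hall : ∀ K' : ℕ, eLpNorm (wfun K' a) 2 volume < ⊤) :
    ∃ (u w : ℝ → EuclideanSpace ℝ ι → EuclideanSpace ℝ ι) (p : ℝ → EuclideanSpace ℝ ι → ℝ),
      (∀ T, 0 < T → IsClassicalDriftNSSolutionOn (Icc 0 T) ν w u p) ∧
      (∀ x, u 0 x = reVec fun l => 𝓕 (fun ξ => a ξ l) x) ∧
      (∀ t, 0 ≤ t → w t = mollify χ (u t)) ∧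
      ContinuousInLpOn (Ici 0) 2 u ∧
      (∀ T, ∫⁻ t in Ioo 0 T, ∫⁻ x, ENNReal.ofReal (frobeniusNormSq (fderiv ℝ (u t) x)) < ⊤) ∧
      (∀ s t, 0 ≤ s → s ≤ t →
        VectorCalculus.kineticEnergy (u t) +
            ν * (∫⁻ τ in Ioo s t, ∫⁻ x, ENNReal.ofReal (frobeniusNormSq (fderiv ℝ (u τ) x))).toReal =
          VectorCalculus.kineticEnergy (u s)) ∧
      (∀ ψ : ℝ → EuclideanSpace ℝ ι → EuclideanSpace ℝ ι, IsSpaceTimeTestOn (⊤ : Opens (ℝ × EuclideanSpace ℝ ι)) ψ →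
        (∀ τ, VectorCalculus.IsDivFree (ψ τ)) → ∀ s t, 0 ≤ s → s ≤ t →
          (∫ x, ⟪u t x, ψ t x⟫) - ∫ x, ⟪u s x, ψ s x⟫ =
            ∫ τ in s..t, ∫ x, (⟪u τ x, timeDeriv ψ τ x⟫ +
              ⟪u τ x, convect (mollify χ (u τ)) (ψ τ) x⟫ + ν * ⟪u τ x, (Δ (ψ τ)) x⟫)) ∧
      (∀ t, 0 ≤ t → eLpNorm (p t) 2 volume ≤
        (((Fintype.card ι ^ 2 : ℕ) : NNReal) : ℝ≥0∞) * eLpNorm (fun x => ‖w t x‖ * ‖u t x‖) 2 volume) := by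
  set c : ℝ := 4 * π ^ 2 * ν with hc
  set m : EuclideanSpace ℝ ι → ℝ := msymbol χ with hm
  -- the global fields
  set ug : ℝ → EuclideanSpace ℝ ι → EuclideanSpace ℝ ι := fun t x =>
    reVec fun l => 𝓕 (fun ξ => gSol c m K a t ξ l) x with hug
  set jg : ℝ → EuclideanSpace ℝ ι → EuclideanSpace ℝ ι := fun t x =>
    reVec fun l => 𝓕 (fun ξ => (m ξ : ℂ) * gSol c m K a t ξ l) x with hjg
  set pg : ℝ → EuclideanSpace ℝ ι → ℝ := fun t x =>
    (𝓕 (presSymbol (vmul m (gSol c m K a t)) (gSol c m K a t)) x).re with hpg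
  -- the setups and the identification of their fields with the global ones on `[0, T]`
  have hset : ∀ T, 0 < T → ∃ d : RegSetup ι, d.ν = ν ∧ d.m = m ∧ d.T = T ∧
      (∀ t ∈ Icc 0 T, d.u t = ug t) ∧ (∀ t ∈ Icc 0 T, d.ju t = jg t) ∧ (∀ t ∈ Icc 0 T, d.p t = pg t) := by
    intro T hT
    obtain ⟨d, hdν, hdm, hdT, hdV⟩ := exists_regSetup_gSol hν h hall hT
    refine ⟨d, hdν, hdm, hdT, fun t ht => ?_, fun t ht => ?_, fun t ht => ?_⟩
    · funext x
      show reVec (d.U t x) = reVec fun l => 𝓕 (fun ξ => gSol c m K a t ξ l) x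
      congr 1
      funext l
      show 𝓕 (fun ξ => d.V t ξ l) x = _
      rw [hdV t ht]
    · funext x
      show reVec (d.JU t x) = reVec fun l => 𝓕 (fun ξ => (m ξ : ℂ) * gSol c m K a t ξ l) x
      congr 1
      funext l
      show 𝓕 (fun ξ => (d.m ξ : ℂ) * d.V t ξ l) x = _
      rw [hdV t ht, hdm]
    · funext x
      show (𝓕 (d.q t) x).re = (𝓕 (presSymbol (vmul m (gSol c m K a t)) (gSol c m K a t)) x).re
      have hq : d.q t = presSymbol (vmul m (gSol c m K a t)) (gSol c m K a t) := by
        funext ξ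
        show presSymbol (vmul d.m (d.V t)) (d.V t) ξ = _
        rw [hdV t ht, hdm]
      rw [hq]
  refine ⟨ug, jg, pg, ?_, ?_, ?_, ?_, ?_, ?_, ?_, ?_⟩
  · -- classical drift solution on every `[0, T]`
    intro T hT
    obtain ⟨d, hdν, -, hdT, hdu, hdju, hdp⟩ := hset T hT
    subst hdν hdT
    exact d.isClassicalDriftNSSolutionOn.congr (fun t ht => (hdu t ht).symm) (fun t ht => (hdju t ht).symm)
      fun t ht => (hdp t ht).symm
  · -- the datum
    intro x
    simp only [hug, h.gSol_zero]
  · -- `w = J_χ u`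
    intro t ht
    obtain ⟨d, -, hdm, hdT, hdu, hdju, -⟩ := hset (t + 1) (by linarith)
    have htI : t ∈ Icc 0 d.T := by rw [hdT]; exact ⟨ht, by linarith⟩
    rw [← hdu t (hdT ▸ htI), ← hdju t (hdT ▸ htI)]
    exact d.ju_eq_mollify χ hdm htI
  · -- `u ∈ C([0, ∞); L²)`
    refine ⟨fun t ht => ?_, fun t₀ ht₀ => ?_⟩
    · obtain ⟨d, -, -, hdT, hdu, -, -⟩ := hset (t + 1) (by have : (0 : ℝ) ≤ t := ht; linarith)
      have htI : t ∈ Icc 0 d.T := by rw [hdT]; exact ⟨ht, by linarith⟩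
      rw [← hdu t (hdT ▸ htI)]
      exact d.memLp_u htI
    · have ht₀' : (0 : ℝ) ≤ t₀ := ht₀
      obtain ⟨d, -, -, hdT, hdu, -, -⟩ := hset (t₀ + 1) (by linarith)
      have ht₀I : t₀ ∈ Icc 0 d.T := by rw [hdT]; exact ⟨ht₀', by linarith⟩
      -- `‖u(t) − u(t₀)‖² ≤ card ι ‖V(t) − V(t₀)‖² → 0`
      have hV := (d.mildK 0).tendsto_eLpNorm_sub t₀
      have hV2 : Tendsto (fun t => (Fintype.card ι : ℝ≥0∞) * eLpNorm (d.V t - d.V t₀) 2 volume ^ 2) (𝓝 t₀) (𝓝 0) := by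
        have h1 : Tendsto (fun t => eLpNorm (d.V t - d.V t₀) 2 volume ^ 2) (𝓝 t₀) (𝓝 0) := by
          have := ((ENNReal.continuous_pow 2).tendsto (0 : ℝ≥0∞)).comp hV
          rw [zero_pow two_ne_zero] at this
          exact this.congr fun s => rfl
        have h2 := ENNReal.Tendsto.const_mul h1 (Or.inr (ENNReal.natCast_ne_top (Fintype.card ι)))
        simpa using h2
      -- squares of the `L²` distances tend to zero along `𝓝[Ici 0] t₀`
      have hsq : Tendsto (fun t => eLpNorm (ug t - ug t₀) 2 volume ^ 2) (𝓝[Ici 0] t₀) (𝓝 0) := by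
        have hev : ∀ᶠ t in 𝓝[Ici 0] t₀, eLpNorm (ug t - ug t₀) 2 volume ^ 2 ≤
            (Fintype.card ι : ℝ≥0∞) * eLpNorm (d.V t - d.V t₀) 2 volume ^ 2 := by
          have hlt : ∀ᶠ t in 𝓝[Ici 0] t₀, t < t₀ + 1 :=
            mem_nhdsWithin_of_mem_nhds (Iio_mem_nhds (by linarith))
          filter_upwards [hlt, self_mem_nhdsWithin] with t ht ht0
          have htI : t ∈ Icc 0 d.T := by rw [hdT]; exact ⟨ht0, ht.le⟩
          rw [← hdu t (hdT ▸ htI), ← hdu t₀ (hdT ▸ ht₀I)]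
          exact d.eLpNorm_u_sub_sq_le ht₀I htI
        exact tendsto_of_tendsto_of_tendsto_of_le_of_le' tendsto_const_nhds (hV2.mono_left nhdsWithin_le_nhds)
          (Eventually.of_forall fun _ => zero_le) hev
      -- remove the square
      have hrt := ((ENNReal.continuous_rpow_const (y := (1 / 2 : ℝ))).tendsto (0 : ℝ≥0∞)).comp hsq
      rw [ENNReal.zero_rpow_of_pos (by norm_num : (0 : ℝ) < 1 / 2)] at hrt
      refine hrt.congr fun t => ?_
      show (eLpNorm (ug t - ug t₀) 2 volume ^ 2) ^ (1 / 2 : ℝ) = eLpNorm (ug t - ug t₀) 2 volume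
      rw [← ENNReal.rpow_natCast, ← ENNReal.rpow_mul]
      norm_num
  · -- finite dissipation
    intro T
    rcases le_or_gt T 0 with hT | hT
    · rw [Ioo_eq_empty (not_lt.2 hT), Measure.restrict_empty, lintegral_zero_measure]
      exact ENNReal.zero_lt_top
    obtain ⟨d, -, -, hdT, hdu, -, -⟩ := hset T hT
    have heq : ∫⁻ t in Ioo 0 T, ∫⁻ x, ENNReal.ofReal (frobeniusNormSq (fderiv ℝ (ug t) x)) =
        ∫⁻ t in Ioo 0 T, ∫⁻ x, ENNReal.ofReal (frobeniusNormSq (fderiv ℝ (d.u t) x)) :=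
      setLIntegral_congr_fun measurableSet_Ioo fun t ht => by rw [hdu t ⟨ht.1.le, ht.2.le⟩]
    rw [heq]
    exact d.lintegral_dissipation_lt_top (le_of_eq hdT.symm)
  · -- energy equality
    intro s t hs hst
    obtain ⟨d, hdν, -, hdT, hdu, -, -⟩ := hset (t + 1) (by linarith)
    have heq : ∫⁻ τ in Ioo s t, ∫⁻ x, ENNReal.ofReal (frobeniusNormSq (fderiv ℝ (ug τ) x)) =
        ∫⁻ τ in Ioo s t, ∫⁻ x, ENNReal.ofReal (frobeniusNormSq (fderiv ℝ (d.u τ) x)) :=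
      setLIntegral_congr_fun measurableSet_Ioo fun τ hτ => by
        rw [hdu τ ⟨hs.trans hτ.1.le, by linarith [hτ.2]⟩]
    rw [heq, ← hdu t ⟨hs.trans hst, by linarith⟩, ← hdu s ⟨hs, by linarith⟩, ← hdν]
    exact d.energyEq hs hst (by rw [hdT]; linarith)
  · -- the regularised weak form
    intro ψ hψ hψdiv s t hs hst
    obtain ⟨d, hdν, hdm, hdT, hdu, hdju, -⟩ := hset (t + 1) (by linarith)
    have hmem : ∀ τ ∈ Icc s t, τ ∈ Icc 0 d.T := fun τ hτ => ⟨hs.trans hτ.1, by rw [hdT]; linarith [hτ.2]⟩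
    have key := d.regularised hψ hψdiv hs hst (by rw [hdT]; linarith)
    rw [hdu t (hdT ▸ hmem t ⟨hst, le_rfl⟩), hdu s (hdT ▸ hmem s ⟨le_rfl, hst⟩), hdν] at key
    rw [key]
    refine intervalIntegral.integral_congr fun τ hτ => ?_
    rw [uIcc_of_le hst] at hτ
    have hτI := hmem τ hτ
    rw [hdu τ (hdT ▸ hτI), d.ju_eq_mollify χ hdm hτI, hdu τ (hdT ▸ hτI)]
  · -- the pressure bound
    intro t ht
    obtain ⟨d, -, -, hdT, hdu, hdju, hdp⟩ := hset (t + 1) (by linarith)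
    have htI : t ∈ Icc 0 d.T := by rw [hdT]; exact ⟨ht, by linarith⟩
    rw [← hdu t (hdT ▸ htI), ← hdju t (hdT ▸ htI), ← hdp t (hdT ▸ htI)]
    exact d.eLpNorm_p_le' htI

end FourierNS

end Literature.Analysis.FluidPDE

end
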